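import Literature.MathematicalPhysics.QuantumFieldTheory.Balaban1983to89.B16LeafFamily

/-!
# `Balaban1983to89.B16EflSup` (v1) — the reader's item `EflBound` REDUCED to a sup-bound on the (2.13) exponent:
`log ∫ χ·e^F dμ ≤ sup_{χ ≠ 0} F` for a normalised measure, kernel-checked and junk-value-audited, and the lineage's
headline `B16LeafFamily.not_uvBound01_of_torusLeaves` re-keyed on it

CITATION HEADER (lean-in-tree rule 2026-08-18).  Source: (B12 = [I]) T. Bałaban, *Renormalization group approach to
lattice gauge field theories. I. Generation of effective actions in a small field approximation and a coupling
constant renormalization in four dimensions*, Commun. Math. Phys. **109**, 249–301 (1987), doi:10.1007/bf01215223,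
bib `Balaban1987RG1` (held: `paper:balaban1987-cmp109-rg-i-small-field`; journal page = PDF page + 248).  The
quotations below were READ AS IMAGES on the x2 page renders of the cell
(`run/shared/lean/pub/pub-balaban/b2b-balaban-ref1/pages/1987-cmp109-rg-I-small-field/…-p018-x2.png`, `…-p019-x2.png`,
`…-p020-x2.png` = [I] pp. 266, 267, 268), not on an OCR layer:

* [I] p. 266 [18], (2.9): *"Finally we can define the characteristic function χ_k
  χ_k = Π_{b ∈ T^{(k)}∖{b₀(c) : c ∈ T^{(k+1)}}} χ({|B′(b)| < ε₁}).   (2.9)"* — a product of characteristic functions,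
  so `χ_k ∈ {0, 1}`.
* [I] p. 267 [19]: *"This quadratic form defines the k-th normalization factor Z^{(k)}(U_{k+1}) given by the formula
  (1.4) with j = k. The quadratic form defines also a Gaussian measure."* and p. 268 [20] l. 3–4: *"… and the measure
  becomes a Gaussian measure in variables B, with the covariance C^{(k)} = C^{(k)}(U_{k+1}) = (C*Δ^{(k)}C)⁻¹."*
* [I] p. 268 [20], (2.12), first line and integral term: *"A_{k+1}(U_{k+1}) = −(1/g_k²) A(U_{k+1}) + E_k(U_{k+1})
  + [log Z^{(k)}(U_{k+1}) − log Z^{(k)}(1)] + log N″_k⁻¹ ∫ dμ_{C^{(k)}}(B) χ_k exp[Tr log(I − h((δ/δB) D̃)(g_k CB)) + …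
  + {E_k(U_k(exp i[g_k CB − hD̃(g_k CB)] V^{(k)})) − E_k(U_k(V^{(k)}))}].   (2.12)"* (the normalisation factor `Z^{(k)}`
  enters (2.12) only through the separate bracket `[log Z^{(k)}(U_{k+1}) − log Z^{(k)}(1)]`); after (2.12): *"Let us
  notice that the normalization constant N″_k is equal to the integral above at U_{k+1} = 1."*; (2.13): *"E^{(k+1)}(g_k, U_{k+1}) = log ∫ dμ_{C^{(k)}}(B) χ_k exp[P^{(k)}(g_k, U_{k+1}, B) + {…}].
  (2.13)"*; and *"Let us remark that the expression under the exponential above vanishes at g_k = 0, and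
  log N″_k = E^{(k+1)}(g_k, 1).   (2.14)"*.

WHAT THIS MODULE DOES (audit cell `pub-balaban`, unit `b2b-balaban-pv24-g7` = SURGE NODE PROVER #24 gen 7, owner
lineage of `B16B10Shape` / `B16ZLower` / `B16TstarCount` / `B16SmallCouplings` / `B16LeafFamily`; journal row
EFLSUP-KERNEL; value = a KERNEL CERTIFICATE of an inference that the cell's records state in prose (GAPS G-pv24-1b;
docstring of `B16B10Shape.CountertermData.EflBound`: *"any bound sup_{χ_k}(P^{(k)}(g_k, 1, B) + {…}) ≤ C_E|T₁^{(k+1)}|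
uniform in g_k ≤ γ gives the item"*), NOT summit progress; nothing of the series is asserted):

* §1 — [folklore] for ANY measure space and ANY real functions `χ`, `F` (no measurability, no integrability): if
  `0 ≤ χ ≤ 1` and `F ≤ M` on `{χ ≠ 0}` then `∫ χ·e^F dμ ≤ e^M · μ(univ)` (`integral_mul_exp_le_exp_mul`), hence
  `≤ e^M` for a probability measure (`integral_mul_exp_le_exp`) and `log ∫ χ·e^F dμ ≤ M` whenever `0 ≤ M`
  (`log_integral_mul_exp_le`) or whenever the integral is positive (`log_integral_mul_exp_le_of_pos`).  JUNK-VALUE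
  AUDIT (cell typing checklist (ii)): Mathlib's Bochner integral of a non-integrable (e.g. non-measurable) integrand is
  `0` and `Real.log 0 = 0`, so WITHOUT `0 ≤ M` (or positivity of the integral) the inequality would be FALSE in
  general — `log_integral_le_needs_sign` records the shape of that failure (χ ≡ 0: the integral is `0`, and the bound
  then FORCES `0 ≤ M`) —, while WITH `0 ≤ M`
  it holds unconditionally; the consumer below has `M = C_E·|T₁^{(j+1)}| ≥ 0`.
* §2 — the PRINTED SHAPE of the fluctuation constant as a carrier: `FluctuationIntegral` = a probability space
  `(Ω, μ)` (the Gaussian measure `dμ_{C^{(k)}}` of p. 267/268, READ as normalised — the meaning of the notation once the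
  normalisation factor `Z^{(k)}` has been separated into the bracket `[log Z^{(k)}(U_{k+1}) − log Z^{(k)}(1)]`, as (2.12)
  does), a cutoff `χ : Ω → [0, 1]` (χ_k of (2.9)) and an
  exponent `F : Ω → ℝ` (`P^{(k)}(g_k, 1, B) + {…}` at `U_{k+1} = 1`); `E Φ := log ∫ χ e^F dμ` = (2.13) at `U_{k+1} = 1`
  = `log N″_k` by (2.14); `SupBound Φ M := ∀ ω, χ ω ≠ 0 → F ω ≤ M`; `E_le_of_supBound`.  The characteristic-function
  constructor `ofSet` (χ = 𝟙_S, (2.9)) and `E_ofSet_le`.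
* §3 — BRIDGE: `not_uvBound01_of_torusLeaves_sup` and `logNormalisedFrom_one_of_torusLeaves_sup` are the lineage's
  `B16LeafFamily.not_uvBound01_of_torusLeaves` / `logNormalisedFrom_one_of_torusLeaves` with the reader's item
  `EflBound` (their binder `hE : E^{(j+1)}(T^{(j+1)}, g_j, 1) ≤ C_E·|T₁^{(j+1)}|`) REPLACED by the sup-bound
  `SupBound (Φ P j) (C_E·|T₁^{(j+1)}|)` on a family `Φ P j : FluctuationIntegral` whose `E` IS the constant
  (`Efl P j := (Φ P j).E`, definitional).
* §4 — NON-VACUITY: the one-point carrier (`trivialΦ`: Dirac measure, χ ≡ 1, F ≡ 0, `E = 0`) satisfies `SupBound 0`,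
  and with the sibling's toy `B16LeafFamily.toyTorus` every hypothesis of the new headline holds at once
  (`toyTorus_sup_hypotheses`).

SCOPE, stated honestly.  This file SHIFTS the open reader's item of the lineage (author question (ii) of cell GAPS
G-pv24-1 / G-pv24-1a: NO printed statement of [I]–[III] bounds `log N″_k`) from «`E^{(k+1)}(g_k, 1) ≤ C_E|T₁^{(k+1)}|`»
to «the (2.13) exponent at `U_{k+1} = 1` is `≤ C_E|T₁^{(k+1)}|` on the support of `χ_k`, uniformly in k and in
`g_k ≤ γ`» — in the words of cell GAPS G-pv24-1b, the shape «the (0.27)/(1.18)-type localized estimates of [I] §1 are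
designed to give after the explicit powers of g_k are extracted»; it DISCHARGES NOTHING of the series,
decides nothing about Bałaban's densities, and is not a claim that such a sup-bound is printed (it is not: G-pv24-1a).
The reading «`dμ_{C^{(k)}}` is a probability measure» is the cell's (DIVERGENCE.md row of this module); were the measure
only finite, §1's `integral_mul_exp_le_exp_mul` gives the same bound up to `+ log μ(univ)`.

ABSOLUTE RULE.  No internally-minted statement enters as a cited fact: every `theorem` below is kernel-proved from
Mathlib and the sibling's DEFINITIONS and THEOREMS; the new `def`s transcribe the printed formula (2.13)/(2.14) into a
carrier and name the reader's sup-bound; every remaining hypothesis of the §3 headline is a located leaf, the labelled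
OPEN reader's item in its new form, or a modelling clause of the cell, exactly as in the sibling; the toy of §4 is a
model, not a claim about the series; the papers' disputed steps are not used.  Imports `B16LeafFamily` (hence
`B16SmallCouplings`, `B16TstarCount`, `B16ZLower`, `FlowStepRuns`, `FlowStep`, `DagBinding`, `B16B10Shape`, `B16`,
`B12`); restates nothing of them.  Mathlib only otherwise; no `sorry` / `axiom`.  Companion: GAPS row C-pv24g7-1,
journal CLAIMS.log `EFLSUP-KERNEL`, HANDOFF.md § b2b-balaban-pv24 gen 7.
-/

open scoped BigOperators
open MeasureTheory

namespace Literature.MathematicalPhysics.QuantumFieldTheory.Balaban1983to89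

namespace B16EflSup

open FlowStep (HBeta BetaUpperH)
open DagBinding (ForwardGenerated)
open B16ZLower (CzSU)
open B16SmallCouplings (LogNormalisedFrom)
open B16LeafFamily (LeafInput sitesR sitesR_nonneg leafE toyTorus toyTorus_forwardGenerated
  not_uvBound01_of_torusLeaves logNormalisedFrom_one_of_torusLeaves)

/-! ## §1. Folklore: the logarithm of a normalised expectation of `χ·e^F` is at most `sup_{χ ≠ 0} F` -/

section Folklore

variable {Ω : Type*}

/-- Pointwise: `0 ≤ χ ω · e^{F ω}` for `χ ≥ 0`. [folklore] -/
theorem mul_exp_nonneg {χ F : Ω → ℝ} (h0 : ∀ ω, 0 ≤ χ ω) (ω : Ω) : 0 ≤ χ ω * Real.exp (F ω) :=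
  mul_nonneg (h0 ω) (Real.exp_nonneg _)

/-- Pointwise: `χ ω · e^{F ω} ≤ e^M` for `χ ≤ 1` and `F ≤ M` on `{χ ≠ 0}` (where `χ ω = 0` the left side is `0`).
[folklore] -/
theorem mul_exp_le_exp {χ F : Ω → ℝ} {M : ℝ} (h1 : ∀ ω, χ ω ≤ 1)
    (hF : ∀ ω, χ ω ≠ 0 → F ω ≤ M) (ω : Ω) : χ ω * Real.exp (F ω) ≤ Real.exp M := by
  by_cases hχ : χ ω = 0
  · rw [hχ, zero_mul]
    exact Real.exp_nonneg _
  · calc χ ω * Real.exp (F ω) ≤ 1 * Real.exp M :=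
          mul_le_mul (h1 ω) (Real.exp_le_exp.2 (hF ω hχ)) (Real.exp_nonneg _) zero_le_one
      _ = Real.exp M := one_mul _

/-- The characteristic function of a set takes values in `[0, 1]` (χ_k of (2.9) is a product of such). [folklore] -/
theorem indicator_one_mem {S : Set Ω} (ω : Ω) : 0 ≤ S.indicator (fun _ => (1 : ℝ)) ω ∧ S.indicator (fun _ => (1 : ℝ)) ω ≤ 1 := by
  by_cases h : ω ∈ S
  · simp [Set.indicator_of_mem h]
  · simp [Set.indicator_of_notMem h]

/-- A finite product of characteristic functions takes values in `[0, 1]` — the shape of χ_k in (2.9) [I] p. 266.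
[folklore] -/
theorem prod_indicator_mem {ι : Type*} (s : Finset ι) (S : ι → Set Ω) (ω : Ω) :
    0 ≤ ∏ i ∈ s, (S i).indicator (fun _ => (1 : ℝ)) ω ∧ ∏ i ∈ s, (S i).indicator (fun _ => (1 : ℝ)) ω ≤ 1 :=
  ⟨Finset.prod_nonneg fun i _ => (indicator_one_mem (S := S i) ω).1,
   Finset.prod_le_one (fun i _ => (indicator_one_mem (S := S i) ω).1) fun i _ => (indicator_one_mem (S := S i) ω).2⟩

variable [MeasurableSpace Ω] (μ : Measure Ω)

/-- **`∫ χ·e^F dμ ≤ e^M · μ(Ω)`** for a finite measure, `0 ≤ χ ≤ 1`, `F ≤ M` on `{χ ≠ 0}` — NO measurability or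
integrability hypothesis on `χ`, `F` (a non-integrable integrand has Bochner integral `0 ≤ e^M·μ(Ω)`).
[folklore] -/
theorem integral_mul_exp_le_exp_mul [IsFiniteMeasure μ] {χ F : Ω → ℝ} {M : ℝ} (h0 : ∀ ω, 0 ≤ χ ω)
    (h1 : ∀ ω, χ ω ≤ 1) (hF : ∀ ω, χ ω ≠ 0 → F ω ≤ M) :
    ∫ ω, χ ω * Real.exp (F ω) ∂μ ≤ Real.exp M * μ.real Set.univ := by
  have hmono : ∫ ω, χ ω * Real.exp (F ω) ∂μ ≤ ∫ _ω, Real.exp M ∂μ :=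
    integral_mono_of_nonneg (Filter.Eventually.of_forall (mul_exp_nonneg h0))
      (integrable_const _) (Filter.Eventually.of_forall (mul_exp_le_exp h1 hF))
  calc ∫ ω, χ ω * Real.exp (F ω) ∂μ ≤ ∫ _ω, Real.exp M ∂μ := hmono
    _ = Real.exp M * μ.real Set.univ := by rw [integral_const, smul_eq_mul, mul_comm]

/-- **`∫ χ·e^F dμ ≤ e^M`** for a probability measure, `0 ≤ χ ≤ 1`, `F ≤ M` on `{χ ≠ 0}` — no measurability or
integrability hypothesis. [folklore] -/
theorem integral_mul_exp_le_exp [IsProbabilityMeasure μ] {χ F : Ω → ℝ} {M : ℝ} (h0 : ∀ ω, 0 ≤ χ ω)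
    (h1 : ∀ ω, χ ω ≤ 1) (hF : ∀ ω, χ ω ≠ 0 → F ω ≤ M) :
    ∫ ω, χ ω * Real.exp (F ω) ∂μ ≤ Real.exp M := by
  have h := integral_mul_exp_le_exp_mul μ h0 h1 hF
  rwa [probReal_univ, mul_one] at h

/-- The integral is non-negative (junk value included). [folklore] -/
theorem integral_mul_exp_nonneg {χ F : Ω → ℝ} (h0 : ∀ ω, 0 ≤ χ ω) : 0 ≤ ∫ ω, χ ω * Real.exp (F ω) ∂μ :=
  integral_nonneg (mul_exp_nonneg h0)

/-- **`log ∫ χ·e^F dμ ≤ M` for `0 ≤ M`**, probability measure, `0 ≤ χ ≤ 1`, `F ≤ M` on `{χ ≠ 0}` — no measurability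
or integrability hypothesis: if the integrand is not integrable the Bochner integral is `0` and `log 0 = 0 ≤ M`; if
the integral vanishes likewise; otherwise `log ∫ ≤ log e^M = M`.  "Jensen is not even needed" (cell GAPS G-pv24-1b).
[folklore] -/
theorem log_integral_mul_exp_le [IsProbabilityMeasure μ] {χ F : Ω → ℝ} {M : ℝ} (hM : 0 ≤ M)
    (h0 : ∀ ω, 0 ≤ χ ω) (h1 : ∀ ω, χ ω ≤ 1) (hF : ∀ ω, χ ω ≠ 0 → F ω ≤ M) :
    Real.log (∫ ω, χ ω * Real.exp (F ω) ∂μ) ≤ M := by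
  rcases (integral_mul_exp_nonneg μ h0 (F := F)).eq_or_lt with h | h
  · rw [← h, Real.log_zero]
    exact hM
  · rw [Real.log_le_iff_le_exp h]
    exact integral_mul_exp_le_exp μ h0 h1 hF

/-- **`log ∫ χ·e^F dμ ≤ M` for a POSITIVE integral** (any sign of `M`), probability measure, `0 ≤ χ ≤ 1`, `F ≤ M` on
`{χ ≠ 0}`. [folklore] -/
theorem log_integral_mul_exp_le_of_pos [IsProbabilityMeasure μ] {χ F : Ω → ℝ} {M : ℝ}
    (hpos : 0 < ∫ ω, χ ω * Real.exp (F ω) ∂μ)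
    (h0 : ∀ ω, 0 ≤ χ ω) (h1 : ∀ ω, χ ω ≤ 1) (hF : ∀ ω, χ ω ≠ 0 → F ω ≤ M) :
    Real.log (∫ ω, χ ω * Real.exp (F ω) ∂μ) ≤ M := by
  rw [Real.log_le_iff_le_exp hpos]
  exact integral_mul_exp_le_exp μ h0 h1 hF

/-- A finite-measure form of the logarithmic bound: `log ∫ χ·e^F dμ ≤ M + log μ(Ω)` when the integral is positive
(so `μ(Ω) > 0`) — what §1 gives if `dμ_{C^{(k)}}` were read as a finite, not normalised, Gaussian measure. [folklore] -/
theorem log_integral_mul_exp_le_add_log [IsFiniteMeasure μ] {χ F : Ω → ℝ} {M : ℝ}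
    (hpos : 0 < ∫ ω, χ ω * Real.exp (F ω) ∂μ)
    (h0 : ∀ ω, 0 ≤ χ ω) (h1 : ∀ ω, χ ω ≤ 1) (hF : ∀ ω, χ ω ≠ 0 → F ω ≤ M) :
    Real.log (∫ ω, χ ω * Real.exp (F ω) ∂μ) ≤ M + Real.log (μ.real Set.univ) := by
  have hle := integral_mul_exp_le_exp_mul μ h0 h1 hF
  have hmass : 0 < μ.real Set.univ := by
    by_contra hneg
    have hz : μ.real Set.univ ≤ 0 := not_lt.1 hneg
    have : ∫ ω, χ ω * Real.exp (F ω) ∂μ ≤ 0 :=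
      hle.trans (mul_nonpos_of_nonneg_of_nonpos (Real.exp_nonneg _) hz)  |>.trans le_rfl
    exact absurd this (not_le.2 hpos)
  calc Real.log (∫ ω, χ ω * Real.exp (F ω) ∂μ) ≤ Real.log (Real.exp M * μ.real Set.univ) :=
        Real.log_le_log hpos hle
    _ = M + Real.log (μ.real Set.univ) := by
        rw [Real.log_mul (Real.exp_ne_zero _) hmass.ne', Real.log_exp]

/-- JUNK-VALUE AUDIT: the sign condition `0 ≤ M` (or positivity of the integral) in `log_integral_mul_exp_le` cannot
be dropped — with `χ ≡ 0` the integral is `0`, `log 0 = 0`, and `0 ≤ M` is then NECESSARY. [folklore] -/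
theorem log_integral_le_needs_sign [IsProbabilityMeasure μ] {M : ℝ}
    (h : Real.log (∫ ω, (fun _ : Ω => (0 : ℝ)) ω * Real.exp ((fun _ : Ω => M - 1) ω) ∂μ) ≤ M) : 0 ≤ M := by
  simpa using h

end Folklore

/-! ## §2. The printed shape of the fluctuation constant: (2.13) at `U_{k+1} = 1`, = `log N″_k` by (2.14) -/

/-- CARRIER for the k-th fluctuation constant in its printed form (2.13)/(2.14) [I] p. 268: a probability space
`(Ω, μ)` — the B-variables with the Gaussian measure `dμ_{C^{(k)}}` (p. 268: *"the measure becomes a Gaussian measure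
in variables B, with the covariance C^{(k)}"*; READ as normalised, the factor `Z^{(k)}` being separated in (2.12)) —, a
cutoff `χ` with values in `[0, 1]` (χ_k of (2.9) p. 266, a product of characteristic functions) and the exponent `F`
(*"P^{(k)}(g_k, U_{k+1}, B) + {…}"* at `U_{k+1} = 1`).  Reader-chosen packaging; nothing about Bałaban's objects is
asserted by inhabiting it. [cite: Balaban1987RG1, (2.13)–(2.14) p.268] -/
structure FluctuationIntegral where
  /-- the space of fluctuation variables B -/
  Ω : Type
  /-- its measurable structure -/
  mΩ : MeasurableSpace Ω
  /-- the (normalised Gaussian) measure dμ_{C^{(k)}} -/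
  μ : Measure Ω
  /-- normalisation -/
  prob : IsProbabilityMeasure μ
  /-- the small-field cutoff χ_k -/
  χ : Ω → ℝ
  /-- χ_k ≥ 0 -/
  χ_nonneg : ∀ ω, 0 ≤ χ ω
  /-- χ_k ≤ 1 -/
  χ_le_one : ∀ ω, χ ω ≤ 1
  /-- the exponent P^{(k)}(g_k, 1, B) + {…} -/
  F : Ω → ℝ

namespace FluctuationIntegral

/-- the measurable structure of the carrier, as an instance -/
instance instMeasurableSpaceΩ (Φ : FluctuationIntegral) : MeasurableSpace Φ.Ω := Φ.mΩ

/-- the normalisation of the carrier's measure, as an instance -/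
instance instIsProbabilityMeasureμ (Φ : FluctuationIntegral) : IsProbabilityMeasure Φ.μ := Φ.prob

variable (Φ : FluctuationIntegral)

/-- (2.13) at `U_{k+1} = 1`: `E^{(k+1)}(g_k, 1) = log ∫ dμ_{C^{(k)}}(B) χ_k exp[P^{(k)}(g_k, 1, B) + {…}]` = `log N″_k`
(2.14). [cite: Balaban1987RG1, (2.13)–(2.14) p.268] -/
noncomputable def E : ℝ := Real.log (∫ ω, Φ.χ ω * Real.exp (Φ.F ω) ∂Φ.μ)

/-- READER'S ITEM in its sup form (labelled; author question (ii) of cell GAPS G-pv24-1 — not printed): the (2.13)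
exponent at `U_{k+1} = 1` is at most `M` on the support of `χ_k`. Hypothesis, never asserted. [folklore] -/
def SupBound (M : ℝ) : Prop := ∀ ω, Φ.χ ω ≠ 0 → Φ.F ω ≤ M

/-- **`E ≤ M` from the sup-bound with `0 ≤ M`** — the one-sided reduction of GAPS G-pv24-1b, kernel form
(`log_integral_mul_exp_le`). [folklore] -/
theorem E_le_of_supBound {M : ℝ} (hM : 0 ≤ M) (h : Φ.SupBound M) : Φ.E ≤ M :=
  log_integral_mul_exp_le Φ.μ hM Φ.χ_nonneg Φ.χ_le_one h

/-- `E ≤ M` from the sup-bound when the integral `N″_k` is positive (any sign of `M`). [folklore] -/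
theorem E_le_of_supBound_of_pos {M : ℝ} (hpos : 0 < ∫ ω, Φ.χ ω * Real.exp (Φ.F ω) ∂Φ.μ) (h : Φ.SupBound M) :
    Φ.E ≤ M :=
  log_integral_mul_exp_le_of_pos Φ.μ hpos Φ.χ_nonneg Φ.χ_le_one h

/-- A sup-bound is monotone in the constant. [folklore] -/
theorem SupBound.mono {M M' : ℝ} (h : Φ.SupBound M) (hMM' : M ≤ M') : Φ.SupBound M' :=
  fun ω hω => (h ω hω).trans hMM'

end FluctuationIntegral

/-- The carrier with `χ = 𝟙_S` the characteristic function of a set `S` (the shape of χ_k in (2.9): the small-field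
event). [cite: Balaban1987RG1, (2.9) p.266] -/
noncomputable def FluctuationIntegral.ofSet (Ω : Type) [MeasurableSpace Ω] (μ : Measure Ω) [IsProbabilityMeasure μ]
    (S : Set Ω) (F : Ω → ℝ) : FluctuationIntegral where
  Ω := Ω
  mΩ := inferInstance
  μ := μ
  prob := inferInstance
  χ := S.indicator fun _ => 1
  χ_nonneg := fun ω => (indicator_one_mem ω).1
  χ_le_one := fun ω => (indicator_one_mem ω).2
  F := F

/-- For `χ = 𝟙_S`: `F ≤ M` on `S` and `0 ≤ M` give `E ≤ M`. [folklore] -/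
theorem E_ofSet_le {Ω : Type} [MeasurableSpace Ω] (μ : Measure Ω) [IsProbabilityMeasure μ] (S : Set Ω)
    (F : Ω → ℝ) {M : ℝ} (hM : 0 ≤ M) (hF : ∀ ω ∈ S, F ω ≤ M) :
    (FluctuationIntegral.ofSet Ω μ S F).E ≤ M := by
  refine (FluctuationIntegral.ofSet Ω μ S F).E_le_of_supBound hM fun ω hω => hF ω ?_
  by_contra hS
  exact hω (show S.indicator (fun _ => (1 : ℝ)) ω = 0 from Set.indicator_of_notMem hS _)

/-! ## §3. Bridge: the lineage's headline with `EflBound` replaced by the sup-bound on the (2.13) exponent -/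

/-- The family of constants read off a family of carriers: `Efl P j := E (Φ P j)` = `E^{(j+1)}(T^{(j+1)}, g_j, 1)` in
the printed form (2.13)/(2.14). [cite: Balaban1987RG1, (2.13)–(2.14) p.268] -/
noncomputable def eflOf (Φ : B12.RunParams → ℕ → FluctuationIntegral) : B12.RunParams → ℕ → ℝ :=
  fun P j => (Φ P j).E

/-- `EflBound` FROM `SupBound`: if on every run of the ]0, γ₁]-family with at least one step the (2.13) exponent at
scale j < K is `≤ C_E·|T₁^{(j+1)}|` on the support of χ_j, then `E^{(j+1)}(T^{(j+1)}, g_j, 1) ≤ C_E·|T₁^{(j+1)}|` there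
(`C_E ≥ 0`; `|T₁^{(j+1)}| = sitesR ≥ 0`). [folklore] -/
theorem eflBound_of_supBound (I : LeafInput) (C : B16.Construction) {γ₁ : ℝ}
    (Φ : B12.RunParams → ℕ → FluctuationIntegral) {CE : ℝ} (hCE : 0 ≤ CE)
    (hsup : ∀ P : B12.RunParams, 1 ≤ P.K → (C P).flow.InInterval γ₁ P.K →
      ∀ j, j < P.K → (Φ P j).SupBound (CE * sitesR I.L P (j + 1))) :
    ∀ P : B12.RunParams, 1 ≤ P.K → (C P).flow.InInterval γ₁ P.K →
      ∀ j, j < P.K → eflOf Φ P j ≤ CE * sitesR I.L P (j + 1) :=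
  fun P hK hI j hj => (Φ P j).E_le_of_supBound (mul_nonneg hCE (sitesR_nonneg _ _ _)) (hsup P hK hI j hj)

/-- **The K₀ = 1 logarithm with explicit constants, keyed on the sup-bound.**  `B16LeafFamily.logNormalisedFrom_one_of_torusLeaves`
with its reader's item `EflBound` (binder `hE`) replaced by `SupBound` on the (2.13) exponents, the constants being
`E (Φ P j)`. [cite: Balaban1988Convergent, Thm 1 p.262 and (1.15) p.249] -/
theorem logNormalisedFrom_one_of_torusLeaves_sup (I : LeafInput) (C : B16.Construction)
    (hsites : ∀ P : B12.RunParams, (C P).numSites 0 = (2 * I.L ^ (P.m + P.K)) ^ 4)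
    {γ₁ : ℝ} (hγ1 : γ₁ ≤ 1) (Φ : B12.RunParams → ℕ → FluctuationIntegral) {CE : ℝ} (hCE : 0 ≤ CE)
    (hsup : ∀ P : B12.RunParams, 1 ≤ P.K → (C P).flow.InInterval γ₁ P.K →
      ∀ j, j < P.K → (Φ P j).SupBound (CE * sitesR I.L P (j + 1)))
    (hρ : ∀ P : B12.RunParams, 1 ≤ P.K → (C P).flow.InInterval γ₁ P.K →
      ∃ V₁ : (C P).Cfg 0, Real.exp (-(leafE I P (C P).flow.g (eflOf Φ P))) ≤ (C P).ρ 0 V₁) :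
    LogNormalisedFrom C γ₁ (3 * (1 - 1 / (I.L : ℝ) ^ 4) * ((I.N * I.N - 1 : ℕ) : ℝ))
      (4 * |I.logσ₀| + CzSU I.N I.ε₀ + CE / (((I.L : ℝ) ^ 4) - 1)) 1 :=
  logNormalisedFrom_one_of_torusLeaves I C hsites hγ1 (eflOf Φ) hCE (eflBound_of_supBound I C Φ hCE hsup) hρ

/-- **(B) REFUTED FROM LOCATED INPUTS + THE SUP FORM OF THE OPEN ITEM.**  `B16LeafFamily.not_uvBound01_of_torusLeaves`
(G = SU(N), N ≥ 2, L ≥ 2, ε₀ > 0; forward generation with β bounded above; step-0 lattices the tori of (0.1); on the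
runs of one ]0, γ₁]-family with at least one step: the [III] Thm 1 p. 262 normalisation leaf at some configuration) with
its reader's item (iv) `EflBound` REPLACED by: (iv′) the fluctuation constants are given in the printed form
(2.13)/(2.14) by carriers `Φ P j` (normalised measure, cutoff in [0, 1], exponent) and the exponent at `U = 1` is
`≤ C_E·|T₁^{(j+1)}|` on the support of χ_j for j < K (`C_E ≥ 0`; OPEN reader's item, author question (ii) of cell GAPS
G-pv24-1 — no printed statement gives it).  Then the constant-exponent reading (B) `B16.UVBound01 C` is FALSE.
Nothing printed asserted; NOT a claim about Bałaban's densities until (iii) and (iv′) are settled. [cite: Balaban1989LargeFieldII, (0.1) pp.355–356] -/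
theorem not_uvBound01_of_torusLeaves_sup (I : LeafInput) (C : B16.Construction) {β : HBeta}
    (hgen : ForwardGenerated C.toB12 β) {γ₀ β' : ℝ} (hγ₀ : 0 < γ₀) (hβ' : 0 ≤ β') (hup : BetaUpperH β' γ₀ β)
    (hsites : ∀ P : B12.RunParams, (C P).numSites 0 = (2 * I.L ^ (P.m + P.K)) ^ 4)
    {γ₁ : ℝ} (hγ₁ : 0 < γ₁) (hγ1 : γ₁ ≤ 1) (Φ : B12.RunParams → ℕ → FluctuationIntegral) {CE : ℝ} (hCE : 0 ≤ CE)
    (hsup : ∀ P : B12.RunParams, 1 ≤ P.K → (C P).flow.InInterval γ₁ P.K →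
      ∀ j, j < P.K → (Φ P j).SupBound (CE * sitesR I.L P (j + 1)))
    (hρ : ∀ P : B12.RunParams, 1 ≤ P.K → (C P).flow.InInterval γ₁ P.K →
      ∃ V₁ : (C P).Cfg 0, Real.exp (-(leafE I P (C P).flow.g (eflOf Φ P))) ≤ (C P).ρ 0 V₁) :
    ¬ B16.UVBound01 C :=
  not_uvBound01_of_torusLeaves I C hgen hγ₀ hβ' hup hsites hγ₁ hγ1 (eflOf Φ) hCE
    (eflBound_of_supBound I C Φ hCE hsup) hρ

/-! ## §4. Non-vacuity -/

/-- The one-point carrier: Dirac measure on `Unit`, `χ ≡ 1`, `F ≡ 0`. A model, not a claim. [folklore] -/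
noncomputable def trivialΦ : FluctuationIntegral where
  Ω := Unit
  mΩ := inferInstance
  μ := Measure.dirac ()
  prob := inferInstance
  χ := fun _ => 1
  χ_nonneg := fun _ => zero_le_one
  χ_le_one := fun _ => le_rfl
  F := fun _ => 0

/-- Its constant vanishes: `log ∫ 1·e^0 dδ = log 1 = 0`. [folklore] -/
theorem trivialΦ_E : trivialΦ.E = 0 := by
  show Real.log (∫ _ω, (1 : ℝ) * Real.exp 0 ∂(Measure.dirac ())) = 0
  simp

/-- It satisfies the sup-bound with constant `0` (hence with every `M ≥ 0`). [folklore] -/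
theorem trivialΦ_supBound : trivialΦ.SupBound 0 := fun _ _ => le_rfl

/-- With the ZERO β-family, the one-point carriers and `C_E = 0`, EVERY hypothesis of `not_uvBound01_of_torusLeaves_sup`
holds for the sibling's toy `B16LeafFamily.toyTorus` (at γ₀ = γ₁ = 1, β′ = 0) — and so does its conclusion: the
re-keyed headline is not vacuous. [folklore] -/
theorem toyTorus_sup_hypotheses (I : LeafInput) :
    let β : HBeta := fun _ _ => 0
    let Φ : B12.RunParams → ℕ → FluctuationIntegral := fun _ _ => trivialΦ
    ForwardGenerated (toyTorus I β (eflOf Φ)).toB12 β ∧ BetaUpperH 0 1 β ∧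
    (∀ P : B12.RunParams, ((toyTorus I β (eflOf Φ)) P).numSites 0 = (2 * I.L ^ (P.m + P.K)) ^ 4) ∧
    (∀ P : B12.RunParams, 1 ≤ P.K → ((toyTorus I β (eflOf Φ)) P).flow.InInterval 1 P.K →
      ∀ j, j < P.K → (Φ P j).SupBound (0 * sitesR I.L P (j + 1))) ∧
    (∀ P : B12.RunParams, 1 ≤ P.K → ((toyTorus I β (eflOf Φ)) P).flow.InInterval 1 P.K →
      ∃ V₁ : ((toyTorus I β (eflOf Φ)) P).Cfg 0,
        Real.exp (-(leafE I P ((toyTorus I β (eflOf Φ)) P).flow.g (eflOf Φ P))) ≤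
          ((toyTorus I β (eflOf Φ)) P).ρ 0 V₁) ∧
    ¬ B16.UVBound01 (toyTorus I β (eflOf Φ)) := by
  intro β Φ
  have hgen := toyTorus_forwardGenerated I β (eflOf Φ)
  have hup : BetaUpperH 0 1 β := fun _ _ _ => le_rfl
  have hsites : ∀ P : B12.RunParams, ((toyTorus I β (eflOf Φ)) P).numSites 0 = (2 * I.L ^ (P.m + P.K)) ^ 4 :=
    fun P => by show (2 * I.L ^ (P.m + P.K - 0)) ^ 4 = _; rw [Nat.sub_zero]
  have hsup : ∀ P : B12.RunParams, 1 ≤ P.K → ((toyTorus I β (eflOf Φ)) P).flow.InInterval 1 P.K →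
      ∀ j, j < P.K → (Φ P j).SupBound (0 * sitesR I.L P (j + 1)) := fun P _ _ j _ => by
    rw [zero_mul]
    exact trivialΦ_supBound
  have hρ : ∀ P : B12.RunParams, 1 ≤ P.K → ((toyTorus I β (eflOf Φ)) P).flow.InInterval 1 P.K →
      ∃ V₁ : ((toyTorus I β (eflOf Φ)) P).Cfg 0,
        Real.exp (-(leafE I P ((toyTorus I β (eflOf Φ)) P).flow.g (eflOf Φ P))) ≤
          ((toyTorus I β (eflOf Φ)) P).ρ 0 V₁ :=
    fun P _ _ => ⟨(), le_rfl⟩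
  exact ⟨hgen, hup, hsites, hsup, hρ,
    not_uvBound01_of_torusLeaves_sup I _ hgen one_pos le_rfl hup hsites one_pos le_rfl Φ le_rfl hsup hρ⟩

end B16EflSup

end Literature.MathematicalPhysics.QuantumFieldTheory.Balaban1983to89
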